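import Summits.Ventures.PercRepro.C026PFunCurvePairsA
import Summits.Ventures.PercRepro.C026PFunCurvePairsB
import Summits.Ventures.PercRepro.C026PFunCurvePairsC
import Summits.Ventures.PercRepro.C026PFunProbeZero

/-!
# THEOREM L2 with a live probe (p6, gen 17; mine-3 §35 (b) complete)

For a skeleton with probe `c` and two live vertices `a, b` (every other vertex bare) at ANY band states — the probe
`(z, κ)` included — the `(P)` functional is nonnegative as soon as the corner identity `(E00)` holds:
**`pFun_threeCells_nonneg_of_E00`**.  The probe on the zero piece `z ≤ ½` is `C026PFunProbeZero`; on the tight curve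
`z = 1 − t`, `κ = K_min(z)` the argument is the bare-probe one of `C026PFunTwoLiveL2` with the curve-probe pair values
of `C026PFunCurvePairsA/B/C` (`threeLiveVal_curve_add_nonneg_of_half`, the dispatcher over the 25 consistent patterns on
the three pieces `(L,H)`, `(H,L)`, `(H,H)` — the strict piece `(L,L)` is excluded by `½ ≤ x₁ ∨ ½ ≤ x₂`), the bilinear
interpolation on the piece `x₁, x₂ ≤ ½` at `K₁ = K₂ = 0` (`threeLiveVal_zero_interp'`) and its `(0, 0)` corner from
`C026PFunCurveProbe` (`pFun_threeCells_corner_nonneg_of_E00`, the comparison `(E_u) ⟸ (E_0)`); K-monotonicity in all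
three `K`-cells finishes.  Corollary: `(CF)` on the skeleton ⟹ THEOREM L2 (`pFun_threeCells_nonneg_of_slackCF`).
-/

namespace PercRepro

namespace MultiGraph

open Finset

/-- The lower corner on the tight curve clears its denominator: `K_min(x)·(2 − x) = 2x − 1` for `x ≥ ½`. -/
theorem kMin_mul_of_half_le {x : ℝ} (hx : 1 / 2 ≤ x) (hx1 : x ≤ 1) : kMin x * (2 - x) = 2 * x - 1 := by
  rw [kMin_eq_of_half_le hx hx1]
  have h : (2 : ℝ) - x ≠ 0 := by linarith
  field_simp

/-- **The dispatcher**: with the probe on the tight curve and the live vertices at their lower corners, off the piece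
`x₁, x₂ < ½`, every symmetrised pair value of every consistent pattern is nonnegative. -/
theorem threeLiveVal_curve_add_nonneg_of_half {t κ x₁ x₂ : ℝ} (ht : 0 ≤ t) (ht' : t ≤ 1 / 2)
    (hκ : κ * (1 + t) = 1 - 2 * t) (hx₁ : 0 ≤ x₁ ∧ x₁ ≤ 1) (hx₂ : 0 ≤ x₂ ∧ x₂ ≤ 1)
    (hhalf : 1 / 2 ≤ x₁ ∨ 1 / 2 ≤ x₂)
    (ra rb rab ba bb bab : Prop) [Decidable ra] [Decidable rb] [Decidable rab] [Decidable ba]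
    [Decidable bb] [Decidable bab] (r1 : ra → rb → rab) (r2 : ra → rab → rb) (r3 : rb → rab → ra)
    (b1 : ba → bb → bab) (b2 : ba → bab → bb) (b3 : bb → bab → ba) :
    0 ≤ threeLiveVal (1 - t) κ x₁ (kMin x₁) x₂ (kMin x₂) ra rb rab ba bb bab +
      threeLiveVal (1 - t) κ x₁ (kMin x₁) x₂ (kMin x₂) ba bb bab ra rb rab := by
  rcases lt_or_ge x₁ (1 / 2) with h1 | h1 <;> rcases lt_or_ge x₂ (1 / 2) with h2 | h2
  · exfalso
    rcases hhalf with h | h <;> linarith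
  · rw [kMin_eq_zero_of_le h1.le]
    have hK₂ := kMin_mul_of_half_le h2 hx₂.2
    by_cases hra : ra <;> by_cases hrb : rb <;> by_cases hrab : rab <;> by_cases hba : ba <;>
      by_cases hbb : bb <;> by_cases hbab : bab <;>
      first
      | exact absurd (r1 hra hrb) hrab
      | exact absurd (r2 hra hrab) hrb
      | exact absurd (r3 hrb hrab) hra
      | exact absurd (b1 hba hbb) hbab
      | exact absurd (b2 hba hbab) hbb
      | exact absurd (b3 hbb hbab) hba
      | exact curve_A_A_LH ht ht' hκ _ _ _ _ _ _ hx₁.1 h1.le h2 hx₂.2 hK₂ hra hrb hrab hba hbb hbab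
      | exact curve_A_B1_LH ht ht' hκ _ _ _ _ _ _ hx₁.1 h1.le h2 hx₂.2 hK₂ hra hrb hrab hba hbb hbab
      | exact curve_A_B2_LH ht ht' hκ _ _ _ _ _ _ hx₁.1 h1.le h2 hx₂.2 hK₂ hra hrb hrab hba hbb hbab
      | exact curve_A_C_LH ht ht' hκ _ _ _ _ _ _ hx₁.1 h1.le h2 hx₂.2 hK₂ hra hrb hrab hba hbb hbab
      | exact curve_A_D_LH ht ht' hκ _ _ _ _ _ _ hx₁.1 h1.le h2 hx₂.2 hK₂ hra hrb hrab hba hbb hbab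
      | exact curve_B1_B1_LH ht ht' _ _ _ _ _ _ hx₁.1 h1.le h2 hx₂.2 hK₂ hra hrb hrab hba hbb hbab
      | exact curve_B1_B2_LH ht ht' hκ _ _ _ _ _ _ hx₁.1 h1.le h2 hx₂.2 hK₂ hra hrb hrab hba hbb hbab
      | exact curve_B1_C_LH ht ht' hκ _ _ _ _ _ _ hx₁.1 h1.le h2 hx₂.2 hK₂ hra hrb hrab hba hbb hbab
      | exact curve_B1_D_LH ht ht' _ _ _ _ _ _ hx₁.1 h1.le h2 hx₂.2 hK₂ hra hrb hrab hba hbb hbab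
      | exact curve_B2_B2_LH ht ht' hκ _ _ _ _ _ _ hx₁.1 h1.le h2 hx₂.2 hK₂ hra hrb hrab hba hbb hbab
      | exact curve_B2_C_LH ht ht' hκ _ _ _ _ _ _ hx₁.1 h1.le h2 hx₂.2 hK₂ hra hrb hrab hba hbb hbab
      | exact curve_B2_D_LH ht ht' hκ _ _ _ _ _ _ hx₁.1 h1.le h2 hx₂.2 hK₂ hra hrb hrab hba hbb hbab
      | exact curve_C_C_LH ht ht' hκ _ _ _ _ _ _ hx₁.1 h1.le h2 hx₂.2 hK₂ hra hrb hrab hba hbb hbab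
      | exact curve_C_D_LH ht ht' hκ _ _ _ _ _ _ hx₁.1 h1.le h2 hx₂.2 hK₂ hra hrb hrab hba hbb hbab
      | exact curve_D_D_LH ht ht' _ _ _ _ _ _ hx₁.1 h1.le h2 hx₂.2 hK₂ hra hrb hrab hba hbb hbab
      | (rw [add_comm]; exact curve_A_B1_LH ht ht' hκ _ _ _ _ _ _ hx₁.1 h1.le h2 hx₂.2 hK₂ hba hbb hbab hra hrb hrab)
      | (rw [add_comm]; exact curve_A_B2_LH ht ht' hκ _ _ _ _ _ _ hx₁.1 h1.le h2 hx₂.2 hK₂ hba hbb hbab hra hrb hrab)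
      | (rw [add_comm]; exact curve_A_C_LH ht ht' hκ _ _ _ _ _ _ hx₁.1 h1.le h2 hx₂.2 hK₂ hba hbb hbab hra hrb hrab)
      | (rw [add_comm]; exact curve_A_D_LH ht ht' hκ _ _ _ _ _ _ hx₁.1 h1.le h2 hx₂.2 hK₂ hba hbb hbab hra hrb hrab)
      | (rw [add_comm]; exact curve_B1_B2_LH ht ht' hκ _ _ _ _ _ _ hx₁.1 h1.le h2 hx₂.2 hK₂ hba hbb hbab hra hrb hrab)
      | (rw [add_comm]; exact curve_B1_C_LH ht ht' hκ _ _ _ _ _ _ hx₁.1 h1.le h2 hx₂.2 hK₂ hba hbb hbab hra hrb hrab)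
      | (rw [add_comm]; exact curve_B1_D_LH ht ht' _ _ _ _ _ _ hx₁.1 h1.le h2 hx₂.2 hK₂ hba hbb hbab hra hrb hrab)
      | (rw [add_comm]; exact curve_B2_C_LH ht ht' hκ _ _ _ _ _ _ hx₁.1 h1.le h2 hx₂.2 hK₂ hba hbb hbab hra hrb hrab)
      | (rw [add_comm]; exact curve_B2_D_LH ht ht' hκ _ _ _ _ _ _ hx₁.1 h1.le h2 hx₂.2 hK₂ hba hbb hbab hra hrb hrab)
      | (rw [add_comm]; exact curve_C_D_LH ht ht' hκ _ _ _ _ _ _ hx₁.1 h1.le h2 hx₂.2 hK₂ hba hbb hbab hra hrb hrab)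
  · rw [kMin_eq_zero_of_le h2.le]
    have hK₁ := kMin_mul_of_half_le h1 hx₁.2
    by_cases hra : ra <;> by_cases hrb : rb <;> by_cases hrab : rab <;> by_cases hba : ba <;>
      by_cases hbb : bb <;> by_cases hbab : bab <;>
      first
      | exact absurd (r1 hra hrb) hrab
      | exact absurd (r2 hra hrab) hrb
      | exact absurd (r3 hrb hrab) hra
      | exact absurd (b1 hba hbb) hbab
      | exact absurd (b2 hba hbab) hbb
      | exact absurd (b3 hbb hbab) hba
      | exact curve_A_A_HL ht ht' hκ _ _ _ _ _ _ h1 hx₁.2 hK₁ hx₂.1 h2.le hra hrb hrab hba hbb hbab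
      | exact curve_A_B1_HL ht ht' hκ _ _ _ _ _ _ h1 hx₁.2 hK₁ hx₂.1 h2.le hra hrb hrab hba hbb hbab
      | exact curve_A_B2_HL ht ht' hκ _ _ _ _ _ _ h1 hx₁.2 hK₁ hx₂.1 h2.le hra hrb hrab hba hbb hbab
      | exact curve_A_C_HL ht ht' hκ _ _ _ _ _ _ h1 hx₁.2 hK₁ hx₂.1 h2.le hra hrb hrab hba hbb hbab
      | exact curve_A_D_HL ht ht' hκ _ _ _ _ _ _ h1 hx₁.2 hK₁ hx₂.1 h2.le hra hrb hrab hba hbb hbab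
      | exact curve_B1_B1_HL ht ht' hκ _ _ _ _ _ _ h1 hx₁.2 hK₁ hx₂.1 h2.le hra hrb hrab hba hbb hbab
      | exact curve_B1_B2_HL ht ht' hκ _ _ _ _ _ _ h1 hx₁.2 hK₁ hx₂.1 h2.le hra hrb hrab hba hbb hbab
      | exact curve_B1_C_HL ht ht' hκ _ _ _ _ _ _ h1 hx₁.2 hK₁ hx₂.1 h2.le hra hrb hrab hba hbb hbab
      | exact curve_B1_D_HL ht ht' hκ _ _ _ _ _ _ h1 hx₁.2 hK₁ hx₂.1 h2.le hra hrb hrab hba hbb hbab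
      | exact curve_B2_B2_HL ht ht' _ _ _ _ _ _ h1 hx₁.2 hK₁ hx₂.1 h2.le hra hrb hrab hba hbb hbab
      | exact curve_B2_C_HL ht ht' hκ _ _ _ _ _ _ h1 hx₁.2 hK₁ hx₂.1 h2.le hra hrb hrab hba hbb hbab
      | exact curve_B2_D_HL ht ht' _ _ _ _ _ _ h1 hx₁.2 hK₁ hx₂.1 h2.le hra hrb hrab hba hbb hbab
      | exact curve_C_C_HL ht ht' hκ _ _ _ _ _ _ h1 hx₁.2 hK₁ hx₂.1 h2.le hra hrb hrab hba hbb hbab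
      | exact curve_C_D_HL ht ht' hκ _ _ _ _ _ _ h1 hx₁.2 hK₁ hx₂.1 h2.le hra hrb hrab hba hbb hbab
      | exact curve_D_D_HL ht ht' _ _ _ _ _ _ h1 hx₁.2 hK₁ hx₂.1 h2.le hra hrb hrab hba hbb hbab
      | (rw [add_comm]; exact curve_A_B1_HL ht ht' hκ _ _ _ _ _ _ h1 hx₁.2 hK₁ hx₂.1 h2.le hba hbb hbab hra hrb hrab)
      | (rw [add_comm]; exact curve_A_B2_HL ht ht' hκ _ _ _ _ _ _ h1 hx₁.2 hK₁ hx₂.1 h2.le hba hbb hbab hra hrb hrab)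
      | (rw [add_comm]; exact curve_A_C_HL ht ht' hκ _ _ _ _ _ _ h1 hx₁.2 hK₁ hx₂.1 h2.le hba hbb hbab hra hrb hrab)
      | (rw [add_comm]; exact curve_A_D_HL ht ht' hκ _ _ _ _ _ _ h1 hx₁.2 hK₁ hx₂.1 h2.le hba hbb hbab hra hrb hrab)
      | (rw [add_comm]; exact curve_B1_B2_HL ht ht' hκ _ _ _ _ _ _ h1 hx₁.2 hK₁ hx₂.1 h2.le hba hbb hbab hra hrb hrab)
      | (rw [add_comm]; exact curve_B1_C_HL ht ht' hκ _ _ _ _ _ _ h1 hx₁.2 hK₁ hx₂.1 h2.le hba hbb hbab hra hrb hrab)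
      | (rw [add_comm]; exact curve_B1_D_HL ht ht' hκ _ _ _ _ _ _ h1 hx₁.2 hK₁ hx₂.1 h2.le hba hbb hbab hra hrb hrab)
      | (rw [add_comm]; exact curve_B2_C_HL ht ht' hκ _ _ _ _ _ _ h1 hx₁.2 hK₁ hx₂.1 h2.le hba hbb hbab hra hrb hrab)
      | (rw [add_comm]; exact curve_B2_D_HL ht ht' _ _ _ _ _ _ h1 hx₁.2 hK₁ hx₂.1 h2.le hba hbb hbab hra hrb hrab)
      | (rw [add_comm]; exact curve_C_D_HL ht ht' hκ _ _ _ _ _ _ h1 hx₁.2 hK₁ hx₂.1 h2.le hba hbb hbab hra hrb hrab)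
  · have hK₁ := kMin_mul_of_half_le h1 hx₁.2
    have hK₂ := kMin_mul_of_half_le h2 hx₂.2
    by_cases hra : ra <;> by_cases hrb : rb <;> by_cases hrab : rab <;> by_cases hba : ba <;>
      by_cases hbb : bb <;> by_cases hbab : bab <;>
      first
      | exact absurd (r1 hra hrb) hrab
      | exact absurd (r2 hra hrab) hrb
      | exact absurd (r3 hrb hrab) hra
      | exact absurd (b1 hba hbb) hbab
      | exact absurd (b2 hba hbab) hbb
      | exact absurd (b3 hbb hbab) hba
      | exact curve_A_A_HH ht ht' hκ _ _ _ _ _ _ h1 hx₁.2 hK₁ h2 hx₂.2 hK₂ hra hrb hrab hba hbb hbab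
      | exact curve_A_B1_HH ht ht' hκ _ _ _ _ _ _ h1 hx₁.2 hK₁ h2 hx₂.2 hK₂ hra hrb hrab hba hbb hbab
      | exact curve_A_B2_HH ht ht' hκ _ _ _ _ _ _ h1 hx₁.2 hK₁ h2 hx₂.2 hK₂ hra hrb hrab hba hbb hbab
      | exact curve_A_C_HH ht ht' hκ _ _ _ _ _ _ h1 hx₁.2 hK₁ h2 hx₂.2 hK₂ hra hrb hrab hba hbb hbab
      | exact curve_A_D_HH ht ht' hκ _ _ _ _ _ _ h1 hx₁.2 hK₁ h2 hx₂.2 hK₂ hra hrb hrab hba hbb hbab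
      | exact curve_B1_B1_HH ht ht' hκ _ _ _ _ _ _ h1 hx₁.2 hK₁ h2 hx₂.2 hK₂ hra hrb hrab hba hbb hbab
      | exact curve_B1_B2_HH ht ht' hκ _ _ _ _ _ _ h1 hx₁.2 hK₁ h2 hx₂.2 hK₂ hra hrb hrab hba hbb hbab
      | exact curve_B1_C_HH ht ht' hκ _ _ _ _ _ _ h1 hx₁.2 hK₁ h2 hx₂.2 hK₂ hra hrb hrab hba hbb hbab
      | exact curve_B1_D_HH ht ht' hκ _ _ _ _ _ _ h1 hx₁.2 hK₁ h2 hx₂.2 hK₂ hra hrb hrab hba hbb hbab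
      | exact curve_B2_B2_HH ht ht' hκ _ _ _ _ _ _ h1 hx₁.2 hK₁ h2 hx₂.2 hK₂ hra hrb hrab hba hbb hbab
      | exact curve_B2_C_HH ht ht' hκ _ _ _ _ _ _ h1 hx₁.2 hK₁ h2 hx₂.2 hK₂ hra hrb hrab hba hbb hbab
      | exact curve_B2_D_HH ht ht' hκ _ _ _ _ _ _ h1 hx₁.2 hK₁ h2 hx₂.2 hK₂ hra hrb hrab hba hbb hbab
      | exact curve_C_C_HH ht ht' hκ _ _ _ _ _ _ h1 hx₁.2 hK₁ h2 hx₂.2 hK₂ hra hrb hrab hba hbb hbab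
      | exact curve_C_D_HH ht ht' hκ _ _ _ _ _ _ h1 hx₁.2 hK₁ h2 hx₂.2 hK₂ hra hrb hrab hba hbb hbab
      | exact curve_D_D_HH ht ht' hκ _ _ _ _ _ _ h1 hx₁.2 hK₁ h2 hx₂.2 hK₂ hra hrb hrab hba hbb hbab
      | (rw [add_comm]; exact curve_A_B1_HH ht ht' hκ _ _ _ _ _ _ h1 hx₁.2 hK₁ h2 hx₂.2 hK₂ hba hbb hbab hra hrb hrab)
      | (rw [add_comm]; exact curve_A_B2_HH ht ht' hκ _ _ _ _ _ _ h1 hx₁.2 hK₁ h2 hx₂.2 hK₂ hba hbb hbab hra hrb hrab)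
      | (rw [add_comm]; exact curve_A_C_HH ht ht' hκ _ _ _ _ _ _ h1 hx₁.2 hK₁ h2 hx₂.2 hK₂ hba hbb hbab hra hrb hrab)
      | (rw [add_comm]; exact curve_A_D_HH ht ht' hκ _ _ _ _ _ _ h1 hx₁.2 hK₁ h2 hx₂.2 hK₂ hba hbb hbab hra hrb hrab)
      | (rw [add_comm]; exact curve_B1_B2_HH ht ht' hκ _ _ _ _ _ _ h1 hx₁.2 hK₁ h2 hx₂.2 hK₂ hba hbb hbab hra hrb hrab)
      | (rw [add_comm]; exact curve_B1_C_HH ht ht' hκ _ _ _ _ _ _ h1 hx₁.2 hK₁ h2 hx₂.2 hK₂ hba hbb hbab hra hrb hrab)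
      | (rw [add_comm]; exact curve_B1_D_HH ht ht' hκ _ _ _ _ _ _ h1 hx₁.2 hK₁ h2 hx₂.2 hK₂ hba hbb hbab hra hrb hrab)
      | (rw [add_comm]; exact curve_B2_C_HH ht ht' hκ _ _ _ _ _ _ h1 hx₁.2 hK₁ h2 hx₂.2 hK₂ hba hbb hbab hra hrb hrab)
      | (rw [add_comm]; exact curve_B2_D_HH ht ht' hκ _ _ _ _ _ _ h1 hx₁.2 hK₁ h2 hx₂.2 hK₂ hba hbb hbab hra hrb hrab)
      | (rw [add_comm]; exact curve_C_D_HH ht ht' hκ _ _ _ _ _ _ h1 hx₁.2 hK₁ h2 hx₂.2 hK₂ hba hbb hbab hra hrb hrab)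

variable {V E : Type*} [Fintype V] [DecidableEq V]

omit [Fintype V] in
/-- Three-live cells in `[0, 1]` lie in `[0, 1]`. -/
theorem threeCells_mem (c a b : V) {z x₁ x₂ : ℝ} (hz : 0 ≤ z ∧ z ≤ 1) (hx₁ : 0 ≤ x₁ ∧ x₁ ≤ 1)
    (hx₂ : 0 ≤ x₂ ∧ x₂ ≤ 1) (v : V) :
    0 ≤ threeCells c a b z x₁ x₂ v ∧ threeCells c a b z x₁ x₂ v ≤ 1 := by
  unfold threeCells
  split_ifs <;> constructor <;> nlinarith [hz.1, hz.2, hx₁.1, hx₁.2, hx₂.1, hx₂.2,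
    mul_nonneg hx₁.1 hx₂.1, mul_nonneg hz.1 hx₁.1, mul_nonneg hz.1 hx₂.1,
    mul_nonneg (mul_nonneg hz.1 hx₁.1) hx₂.1]

omit [Fintype V] in
/-- Three-live cells with nonnegative values are nonnegative. -/
theorem threeCells_nonneg (c a b : V) {κ K₁ K₂ : ℝ} (hκ : 0 ≤ κ) (h₁ : 0 ≤ K₁) (h₂ : 0 ≤ K₂) (v : V) :
    0 ≤ threeCells c a b κ K₁ K₂ v := by
  unfold threeCells
  split_ifs <;> positivity

omit [Fintype V] in
/-- Three-live cells are monotone in the three values (nonnegative cells). -/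
theorem threeCells_le_threeCells (c a b : V) {κ K₁ K₂ κ' K₁' K₂' : ℝ} (hκ : 0 ≤ κ) (h₁ : 0 ≤ K₁)
    (h₂ : 0 ≤ K₂) (hκ' : κ ≤ κ') (h₁' : K₁ ≤ K₁') (h₂' : K₂ ≤ K₂') (v : V) :
    threeCells c a b κ K₁ K₂ v ≤ threeCells c a b κ' K₁' K₂' v := by
  unfold threeCells
  split_ifs <;> nlinarith [mul_le_mul h₁' h₂' h₂ (by linarith), mul_nonneg h₁ h₂,
    mul_le_mul hκ' h₁' h₁ (by linarith), mul_le_mul hκ' h₂' h₂ (by linarith),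
    mul_le_mul hκ' (mul_le_mul h₁' h₂' h₂ (by linarith)) (mul_nonneg h₁ h₂) (by linarith)]

omit [Fintype V] in
/-- The probe's three-live cell is at most `z`. -/
theorem threeCells_apply_self_le (c a b : V) {z x₁ x₂ : ℝ} (hz : 0 ≤ z) (hx₁ : 0 ≤ x₁ ∧ x₁ ≤ 1)
    (hx₂ : 0 ≤ x₂ ∧ x₂ ≤ 1) : threeCells c a b z x₁ x₂ c ≤ z := by
  unfold threeCells
  rw [if_pos rfl]
  split_ifs <;> nlinarith [mul_nonneg hx₁.1 hx₂.1, mul_nonneg hz hx₁.1, mul_nonneg hz hx₂.1,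
    mul_nonneg (mul_nonneg hz hx₁.1) hx₂.1, mul_le_mul_of_nonneg_left hx₁.2 hz,
    mul_le_mul_of_nonneg_left hx₂.2 hz,
    mul_le_mul_of_nonneg_left (mul_le_one₀ hx₁.2 hx₂.1 hx₂.2) hz]

variable [Fintype E] [DecidableEq E] {G : MultiGraph V E}

open Classical in
/-- **Off the piece, probe on the curve, live corners**: `(P) ≥ 0`. -/
theorem pFun_threeCells_nonneg_of_half_curve (c a b : V) {t κ x₁ x₂ : ℝ} (ht : 0 ≤ t) (ht' : t ≤ 1 / 2)
    (hκ : κ * (1 + t) = 1 - 2 * t) (hx₁ : 0 ≤ x₁ ∧ x₁ ≤ 1) (hx₂ : 0 ≤ x₂ ∧ x₂ ≤ 1)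
    (hhalf : 1 / 2 ≤ x₁ ∨ 1 / 2 ≤ x₂) :
    0 ≤ G.pFun c (threeCells c a b (1 - t) x₁ x₂) (threeCells c a b κ (kMin x₁) (kMin x₂)) univ := by
  rw [pFun_threeCells_eq_sum c a b (1 - t) κ hx₁ hx₂ (kMin x₁) (kMin x₂)]
  have hsym : ∀ f : Config E → ℝ, ∑ ω, f ω = (∑ ω, (f ω + f ωᶜ)) / 2 := by
    intro f
    rw [Finset.sum_add_distrib, sum_compl_config_eq f]
    ring
  rw [hsym]
  refine div_nonneg (Finset.sum_nonneg fun ω _ => ?_) (by norm_num)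
  simp only [compl_compl]
  exact threeLiveVal_curve_add_nonneg_of_half ht ht' hκ hx₁ hx₂ hhalf _ _ _ _ _ _
    (fun h1 h2 => h1.symm.trans h2) (fun h1 h2 => h1.trans h2) (fun h1 h2 => h1.trans h2.symm)
    (fun h1 h2 => h1.symm.trans h2) (fun h1 h2 => h1.trans h2) (fun h1 h2 => h1.trans h2.symm)

omit [Fintype V] [DecidableEq V] [Fintype E] [DecidableEq E] in
/-- At `K₁ = K₂ = 0` the summand is bilinear in `(x₁, x₂)` for every probe cell: the Lagrange
interpolation on `{0, ½}²`. -/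
theorem threeLiveVal_zero_interp (z κ x₁ x₂ : ℝ) (ra rb rab ba bb bab : Prop) [Decidable ra]
    [Decidable rb] [Decidable rab] [Decidable ba] [Decidable bb] [Decidable bab] :
    threeLiveVal z κ x₁ 0 x₂ 0 ra rb rab ba bb bab =
      (1 - 2 * x₁) * (1 - 2 * x₂) * threeLiveVal z κ 0 0 0 0 ra rb rab ba bb bab +
        (2 * x₁) * (1 - 2 * x₂) * threeLiveVal z κ (1 / 2) 0 0 0 ra rb rab ba bb bab +
        (1 - 2 * x₁) * (2 * x₂) * threeLiveVal z κ 0 0 (1 / 2) 0 ra rb rab ba bb bab +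
        (2 * x₁) * (2 * x₂) * threeLiveVal z κ (1 / 2) 0 (1 / 2) 0 ra rb rab ba bb bab := by
  unfold threeLiveVal nOff
  split_ifs <;> ring

open Classical in
/-- **`(P)` is bilinear on the piece `K₁ = K₂ = 0`** for every probe cell. -/
theorem pFun_threeCells_zero_interp (c a b : V) (z κ : ℝ) {x₁ x₂ : ℝ} (hx₁ : 0 ≤ x₁ ∧ x₁ ≤ 1)
    (hx₂ : 0 ≤ x₂ ∧ x₂ ≤ 1) :
    G.pFun c (threeCells c a b z x₁ x₂) (threeCells c a b κ 0 0) univ =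
      (1 - 2 * x₁) * (1 - 2 * x₂) * G.pFun c (threeCells c a b z 0 0) (threeCells c a b κ 0 0) univ +
        (2 * x₁) * (1 - 2 * x₂) *
          G.pFun c (threeCells c a b z (1 / 2) 0) (threeCells c a b κ 0 0) univ +
        (1 - 2 * x₁) * (2 * x₂) *
          G.pFun c (threeCells c a b z 0 (1 / 2)) (threeCells c a b κ 0 0) univ +
        (2 * x₁) * (2 * x₂) *
          G.pFun c (threeCells c a b z (1 / 2) (1 / 2)) (threeCells c a b κ 0 0) univ := by
  have h0 : (0 : ℝ) ≤ 0 ∧ (0 : ℝ) ≤ 1 := by norm_num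
  have hh : (0 : ℝ) ≤ 1 / 2 ∧ (1 / 2 : ℝ) ≤ 1 := by norm_num
  rw [pFun_threeCells_eq_sum c a b z κ hx₁ hx₂ 0 0, pFun_threeCells_eq_sum c a b z κ h0 h0 0 0,
    pFun_threeCells_eq_sum c a b z κ hh h0 0 0, pFun_threeCells_eq_sum c a b z κ h0 hh 0 0,
    pFun_threeCells_eq_sum c a b z κ hh hh 0 0]
  simp only [Finset.mul_sum, ← Finset.sum_add_distrib]
  exact Finset.sum_congr rfl fun ω _ => threeLiveVal_zero_interp z κ x₁ x₂ _ _ _ _ _ _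

open Classical in
/-- **THEOREM L2 with the probe on the tight curve**: `z = 1 − t`, `κ(1 + t) = 1 − 2t`, `t ∈ [0, ½]`,
band states of the live vertices, `(E00)` ⟹ `(P) ≥ 0`. -/
theorem pFun_threeCells_nonneg_of_E00_curve (c a b : V) {t κ x₁ K₁ x₂ K₂ : ℝ} (ht : 0 ≤ t)
    (ht' : t ≤ 1 / 2) (hκ : κ * (1 + t) = 1 - 2 * t) (hx₁ : 0 ≤ x₁ ∧ x₁ ≤ 1)
    (hx₂ : 0 ≤ x₂ ∧ x₂ ≤ 1) (hK₁ : kMin x₁ ≤ K₁) (hK₂ : kMin x₂ ≤ K₂)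
    (hE00 : 0 ≤ G.pFun c (liveCells a b) (liveCells a b) univ) :
    0 ≤ G.pFun c (threeCells c a b (1 - t) x₁ x₂) (threeCells c a b κ K₁ K₂) univ := by
  have hκ0 : 0 ≤ κ := by nlinarith
  have hz : 0 ≤ 1 - t ∧ 1 - t ≤ 1 := ⟨by linarith, by linarith⟩
  have hK₁0 : 0 ≤ K₁ := (kMin_nonneg x₁).trans hK₁
  have hK₂0 : 0 ≤ K₂ := (kMin_nonneg x₂).trans hK₂
  by_cases hhalf : 1 / 2 ≤ x₁ ∨ 1 / 2 ≤ x₂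
  · refine (pFun_threeCells_nonneg_of_half_curve c a b (G := G) ht ht' hκ hx₁ hx₂ hhalf).trans ?_
    exact pFun_mono_K (threeCells_mem c a b hz hx₁ hx₂)
      (threeCells_nonneg c a b hκ0 (kMin_nonneg x₁) (kMin_nonneg x₂))
      (threeCells_le_threeCells c a b hκ0 (kMin_nonneg x₁) (kMin_nonneg x₂) le_rfl hK₁ hK₂) univ
  · have hx₁' : x₁ ≤ 1 / 2 := by
      by_contra h
      exact hhalf (Or.inl (by linarith))
    have hx₂' : x₂ ≤ 1 / 2 := by
      by_contra h
      exact hhalf (Or.inr (by linarith))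
    have h01 : (0 : ℝ) ≤ 0 ∧ (0 : ℝ) ≤ 1 := by norm_num
    have hh : (0 : ℝ) ≤ 1 / 2 ∧ (1 / 2 : ℝ) ≤ 1 := by norm_num
    have hmono : G.pFun c (threeCells c a b (1 - t) x₁ x₂) (threeCells c a b κ 0 0) univ ≤
        G.pFun c (threeCells c a b (1 - t) x₁ x₂) (threeCells c a b κ K₁ K₂) univ :=
      pFun_mono_K (threeCells_mem c a b hz hx₁ hx₂) (threeCells_nonneg c a b hκ0 le_rfl le_rfl)
        (threeCells_le_threeCells c a b hκ0 le_rfl le_rfl le_rfl hK₁0 hK₂0) univ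
    refine le_trans ?_ hmono
    rw [pFun_threeCells_zero_interp c a b (1 - t) κ hx₁ hx₂]
    have k0 : kMin (0 : ℝ) = 0 := kMin_eq_zero_of_le (by norm_num)
    have kh : kMin (1 / 2 : ℝ) = 0 := kMin_eq_zero_of_le (by norm_num)
    have c00 := pFun_threeCells_corner_nonneg_of_E00 c a b (G := G) ⟨ht, ht'⟩ hκ hE00
    have c10 := pFun_threeCells_nonneg_of_half_curve c a b (G := G) ht ht' hκ hh h01 (Or.inl le_rfl)
    have c01 := pFun_threeCells_nonneg_of_half_curve c a b (G := G) ht ht' hκ h01 hh (Or.inr le_rfl)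
    have c11 := pFun_threeCells_nonneg_of_half_curve c a b (G := G) ht ht' hκ hh hh (Or.inl le_rfl)
    rw [kh, k0] at c10 c01
    rw [kh] at c11
    have w1 : 0 ≤ 1 - 2 * x₁ := by linarith
    have w2 : 0 ≤ 1 - 2 * x₂ := by linarith
    have w3 : 0 ≤ 2 * x₁ := by linarith [hx₁.1]
    have w4 : 0 ≤ 2 * x₂ := by linarith [hx₂.1]
    have t1 := mul_nonneg (mul_nonneg w1 w2) c00
    have t2 := mul_nonneg (mul_nonneg w3 w2) c10
    have t3 := mul_nonneg (mul_nonneg w1 w4) c01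
    have t4 := mul_nonneg (mul_nonneg w3 w4) c11
    linarith

open Classical in
/-- **THEOREM L2 with a live probe** (mine-3 §35 (b), complete): for ANY band state of the probe
`(z, κ)` and of the two live vertices `a, b` (every other vertex bare), `(E00)` ⟹ `(P) ≥ 0`. -/
theorem pFun_threeCells_nonneg_of_E00 (c a b : V) {z κ x₁ K₁ x₂ K₂ : ℝ} (hz : 0 ≤ z ∧ z ≤ 1)
    (hκ : kMin z ≤ κ) (hx₁ : 0 ≤ x₁ ∧ x₁ ≤ 1) (hx₂ : 0 ≤ x₂ ∧ x₂ ≤ 1) (hK₁ : kMin x₁ ≤ K₁)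
    (hK₂ : kMin x₂ ≤ K₂) (hE00 : 0 ≤ G.pFun c (liveCells a b) (liveCells a b) univ) :
    0 ≤ G.pFun c (threeCells c a b z x₁ x₂) (threeCells c a b κ K₁ K₂) univ := by
  have hκ0 : 0 ≤ κ := (kMin_nonneg z).trans hκ
  have hK₁0 : 0 ≤ K₁ := (kMin_nonneg x₁).trans hK₁
  have hK₂0 : 0 ≤ K₂ := (kMin_nonneg x₂).trans hK₂
  rcases le_or_gt z (1 / 2) with hz' | hz'
  · -- the probe on the zero piece: `C026PFunProbeZero`
    exact pFun_nonneg_of_probe_half (threeCells_mem c a b hz hx₁ hx₂)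
      (threeCells_nonneg c a b hκ0 hK₁0 hK₂0)
      ((threeCells_apply_self_le c a b hz.1 hx₁ hx₂).trans hz') univ
  · -- the probe on the tight curve: `t = 1 − z`, `κ₀ = K_min(z)`, then K-monotonicity in `κ`
    have ht : 0 ≤ 1 - z := by linarith
    have ht' : 1 - z ≤ 1 / 2 := by linarith
    have hκ₀ : kMin z * (1 + (1 - z)) = 1 - 2 * (1 - z) := by
      have := kMin_mul_of_half_le hz'.le hz.2
      linear_combination this
    have h0 := pFun_threeCells_nonneg_of_E00_curve c a b (G := G) ht ht' hκ₀ hx₁ hx₂ hK₁ hK₂ hE00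
    rw [show (1 : ℝ) - (1 - z) = z by ring] at h0
    refine h0.trans (pFun_mono_K (threeCells_mem c a b hz hx₁ hx₂)
      (threeCells_nonneg c a b (kMin_nonneg z) hK₁0 hK₂0)
      (threeCells_le_threeCells c a b (kMin_nonneg z) hK₁0 hK₂0 hκ le_rfl le_rfl) univ)

open Classical in
/-- **`(CF)` on the skeleton ⟹ THEOREM L2 with a live probe.** -/
theorem pFun_threeCells_nonneg_of_slackCF (c a b : V) (hCF : 0 ≤ G.slackCF a b c)
    {z κ x₁ K₁ x₂ K₂ : ℝ} (hz : 0 ≤ z ∧ z ≤ 1) (hκ : kMin z ≤ κ) (hx₁ : 0 ≤ x₁ ∧ x₁ ≤ 1)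
    (hx₂ : 0 ≤ x₂ ∧ x₂ ≤ 1) (hK₁ : kMin x₁ ≤ K₁) (hK₂ : kMin x₂ ≤ K₂) :
    0 ≤ G.pFun c (threeCells c a b z x₁ x₂) (threeCells c a b κ K₁ K₂) univ :=
  pFun_threeCells_nonneg_of_E00 c a b hz hκ hx₁ hx₂ hK₁ hK₂
    (pFun_liveCells_nonneg_of_slackCF a b c hCF)

end MultiGraph

end PercRepro
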